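import Summits.Ventures.PercRepro.RankLevelSetBiIndepLRSum

/-! # RankLevelSetBiIndepPF2 — THE LORENTZIAN ULC FACT GIVES THE PF₂ PROFILE, HENCE THE DIRECT-SUM CLOSURE OF (LR)
UNDER THE NAMED FACT (night-1 g26; dossier §38.10)

`BiIndepULC N` (the cited Lorentzian theorem in its normalised form `d_{r−1} d_{r+1} ≤ d_r²`, `d_r = D_r / C(n,r)`,
with no internal zeros) implies the unnormalised log-concavity `D_{r−1} D_{r+1} ≤ D_r²` (binomial coefficients are
log-concave: `C(n,r−1)·C(n,r+1) ≤ C(n,r)²`), and log-concavity with no internal zeros gives the all-spreads form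
`BiIndepPF2 N` (`lc_spread`: `D_{u−1} D_{v+1} ≤ D_u D_v` for `1 ≤ u ≤ v`, then iterate). Hence
`biIndepLR_disjointSum_of_ULC`: `BiIndepLR M → BiIndepLR N → BiIndepULC M → BiIndepULC N → BiIndepLR (M ⊕ N)`.
Nothing here asserts (LR) or ULC; every declaration has a docstring; imports: the cell's own modules and Mathlib
only. Axioms: standard. -/

namespace PercRepro

open Set Matroid

variable {α : Type}

/-- **Binomial coefficients are log-concave**: `C(n, r−1) · C(n, r+1) ≤ C(n, r)²` for `1 ≤ r`, `r + 1 ≤ n`. -/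
lemma choose_sq_ge_choose_pred_mul_choose_succ {n r : ℕ} (hr : 1 ≤ r) (hrn : r + 1 ≤ n) :
    n.choose (r - 1) * n.choose (r + 1) ≤ n.choose r ^ 2 := by
  -- `C(n,r+1)·(r+1) = C(n,r)·(n−r)` and `C(n,r)·r = C(n,r−1)·(n−r+1)`
  have h1 : n.choose (r + 1) * (r + 1) = n.choose r * (n - r) := Nat.choose_succ_right_eq n r
  have h2 : n.choose r * r = n.choose (r - 1) * (n - (r - 1)) := by
    have := Nat.choose_succ_right_eq n (r - 1)
    rwa [show r - 1 + 1 = r by omega] at this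
  have hpos : 0 < n - (r - 1) := by omega
  have hrpos : 0 < r + 1 := by omega
  -- multiply the target by `r·(r+1)·(n−r+1)` and use the two identities
  have key : n.choose (r - 1) * n.choose (r + 1) * ((r + 1) * (n - (r - 1))) =
      n.choose r ^ 2 * (r * (n - r)) := by
    calc n.choose (r - 1) * n.choose (r + 1) * ((r + 1) * (n - (r - 1)))
        = (n.choose (r - 1) * (n - (r - 1))) * (n.choose (r + 1) * (r + 1)) := by ring
      _ = (n.choose r * r) * (n.choose r * (n - r)) := by rw [← h2, h1]
      _ = n.choose r ^ 2 * (r * (n - r)) := by ring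
  have hle : r * (n - r) ≤ (r + 1) * (n - (r - 1)) := by
    have : n - r ≤ n - (r - 1) := by omega
    exact Nat.mul_le_mul (by omega) this
  have hposprod : 0 < (r + 1) * (n - (r - 1)) := Nat.mul_pos hrpos hpos
  by_contra hcon
  rw [not_le] at hcon
  have : n.choose r ^ 2 * (r * (n - r)) < n.choose (r - 1) * n.choose (r + 1) * ((r + 1) * (n - (r - 1))) :=
    calc n.choose r ^ 2 * (r * (n - r)) ≤ n.choose r ^ 2 * ((r + 1) * (n - (r - 1))) :=
          Nat.mul_le_mul_left _ hle
      _ < n.choose (r - 1) * n.choose (r + 1) * ((r + 1) * (n - (r - 1))) :=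
          Nat.mul_lt_mul_of_pos_right hcon hposprod
  omega

/-- **Unnormalised log-concavity from the ULC fact**: `D_{r−1} · D_{r+1} ≤ D_r²` for `1 ≤ r`, `r + 1 ≤ #E`. -/
lemma biIndepCount_lc_of_ULC (N : Matroid α) [N.Finite] (hN : BiIndepULC N) {r : ℕ} (hr : 1 ≤ r)
    (hrn : r + 1 ≤ N.E.ncard) :
    biIndepCount N (r - 1) * biIndepCount N (r + 1) ≤ biIndepCount N r ^ 2 := by
  obtain ⟨hlc, -⟩ := hN
  have h := hlc r hr hrn
  unfold biIndepNorm at h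
  set n := N.E.ncard with hn
  have hC0 : (0 : ℚ) < (n.choose (r - 1) : ℚ) := by exact_mod_cast Nat.choose_pos (by omega)
  have hC1 : (0 : ℚ) < (n.choose r : ℚ) := by exact_mod_cast Nat.choose_pos (by omega)
  have hC2 : (0 : ℚ) < (n.choose (r + 1) : ℚ) := by exact_mod_cast Nat.choose_pos hrn
  have hbin : ((n.choose (r - 1) * n.choose (r + 1) : ℕ) : ℚ) ≤ ((n.choose r ^ 2 : ℕ) : ℚ) := by
    exact_mod_cast choose_sq_ge_choose_pred_mul_choose_succ hr hrn
  push_cast at hbin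
  rw [div_mul_div_comm, div_pow, div_le_div_iff₀ (by positivity) (by positivity)] at h
  -- `h : D_{r−1} D_{r+1} · C_r² ≤ D_r² · (C_{r−1} C_{r+1})`
  have h' : ((biIndepCount N (r - 1) : ℚ) * (biIndepCount N (r + 1) : ℚ)) * ((n.choose r : ℚ) ^ 2) ≤
      ((biIndepCount N r : ℚ) ^ 2) * ((n.choose r : ℚ) ^ 2) := by
    calc ((biIndepCount N (r - 1) : ℚ) * (biIndepCount N (r + 1) : ℚ)) * ((n.choose r : ℚ) ^ 2)
        ≤ ((biIndepCount N r : ℚ) ^ 2) * ((n.choose (r - 1) : ℚ) * (n.choose (r + 1) : ℚ)) := h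
      _ ≤ ((biIndepCount N r : ℚ) ^ 2) * ((n.choose r : ℚ) ^ 2) :=
          mul_le_mul_of_nonneg_left hbin (by positivity)
  have h'' := le_of_mul_le_mul_right h' (by positivity)
  exact_mod_cast h''

/-- **Log-concavity with no internal zeros spreads**: `D_{u−1} · D_{v+1} ≤ D_u · D_v` for `1 ≤ u ≤ v`,
`v + 1 ≤ #E`. -/
lemma lc_spread (N : Matroid α) [N.Finite] (hN : BiIndepULC N) {u v : ℕ} (hu : 1 ≤ u) (huv : u ≤ v)
    (hvn : v + 1 ≤ N.E.ncard) :
    biIndepCount N (u - 1) * biIndepCount N (v + 1) ≤ biIndepCount N u * biIndepCount N v := by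
  induction v, huv using Nat.le_induction with
  | base =>
    have := biIndepCount_lc_of_ULC N hN hu hvn
    rwa [pow_two] at this
  | succ v huv ih =>
    have ih' := ih (by omega)
    have hlc := biIndepCount_lc_of_ULC N hN (r := v + 1) (by omega) hvn
    rw [show v + 1 - 1 = v by omega, pow_two] at hlc
    -- `D_{u−1} D_{v+2} · (D_v D_{v+1}) ≤ D_u D_{v+1} · (D_v D_{v+1})`
    obtain ⟨-, hnz⟩ := hN
    by_cases h0 : biIndepCount N v * biIndepCount N (v + 1) = 0
    · -- an internal zero forces a zero endpoint
      rcases Nat.mul_eq_zero.mp h0 with hv | hv1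
      · by_cases hl : biIndepCount N (u - 1) = 0
        · rw [hl, zero_mul]; exact Nat.zero_le _
        · by_cases hr : biIndepCount N (v + 1 + 1) = 0
          · rw [hr, mul_zero]; exact Nat.zero_le _
          · exfalso
            have := hnz (u - 1) v (v + 1 + 1) (by omega) (by omega) (Nat.pos_of_ne_zero hl) (Nat.pos_of_ne_zero hr)
            omega
      · by_cases hl : biIndepCount N (u - 1) = 0
        · rw [hl, zero_mul]; exact Nat.zero_le _
        · by_cases hr : biIndepCount N (v + 1 + 1) = 0
          · rw [hr, mul_zero]; exact Nat.zero_le _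
          · exfalso
            have := hnz (u - 1) (v + 1) (v + 1 + 1) (by omega) (by omega) (Nat.pos_of_ne_zero hl)
              (Nat.pos_of_ne_zero hr)
            omega
    · have hpos : 0 < biIndepCount N v * biIndepCount N (v + 1) := Nat.pos_of_ne_zero h0
      have key : biIndepCount N (u - 1) * biIndepCount N (v + 1 + 1) * (biIndepCount N v * biIndepCount N (v + 1)) ≤
          biIndepCount N u * biIndepCount N (v + 1) * (biIndepCount N v * biIndepCount N (v + 1)) := by
        calc biIndepCount N (u - 1) * biIndepCount N (v + 1 + 1) * (biIndepCount N v * biIndepCount N (v + 1))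
            = (biIndepCount N (u - 1) * biIndepCount N (v + 1)) * (biIndepCount N v * biIndepCount N (v + 1 + 1)) := by
              ring
          _ ≤ (biIndepCount N u * biIndepCount N v) * (biIndepCount N (v + 1) * biIndepCount N (v + 1)) :=
              Nat.mul_le_mul ih' hlc
          _ = biIndepCount N u * biIndepCount N (v + 1) * (biIndepCount N v * biIndepCount N (v + 1)) := by ring
      exact Nat.le_of_mul_le_mul_right key hpos

/-- **The ULC fact gives the PF₂ profile**: `BiIndepULC N → BiIndepPF2 N`. -/
theorem biIndepPF2_of_ULC (N : Matroid α) [N.Finite] (hN : BiIndepULC N) : BiIndepPF2 N := by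
  intro x y k hxy hkx
  induction k with
  | zero => simp
  | succ k ih =>
    have ih' := ih (by omega)
    by_cases hyn : y + k + 1 ≤ N.E.ncard
    · have hs := lc_spread N hN (u := x - k) (v := y + k) (by omega) (by omega) hyn
      rw [show x - k - 1 = x - (k + 1) by omega, show y + k + 1 = y + (k + 1) by omega] at hs
      exact hs.trans ih'
    · -- `D_{y+k+1} = 0` beyond the ground set
      have : biIndepCount N (y + (k + 1)) = 0 := by
        unfold biIndepCount
        rw [biIndep_eq_empty_of_lt N (by omega), Set.ncard_empty]
      rw [this, mul_zero]
      exact Nat.zero_le _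

/-- **THE (LR)-CLASS IS CLOSED UNDER DIRECT SUMS, UNDER THE NAMED ULC FACT FOR THE SUMMANDS**:
`BiIndepLR M → BiIndepLR N → BiIndepULC M → BiIndepULC N → BiIndepLR (M ⊕ N)`. -/
theorem biIndepLR_disjointSum_of_ULC {M N : Matroid α} [M.Finite] [N.Finite] {h : Disjoint M.E N.E}
    (hM : BiIndepLR M) (hN : BiIndepLR N) (hM2 : BiIndepULC M) (hN2 : BiIndepULC N) :
    BiIndepLR (M.disjointSum N h) :=
  biIndepLR_disjointSum (h := h) hM hN (biIndepPF2_of_ULC M hM2) (biIndepPF2_of_ULC N hN2)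

end PercRepro
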